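import Mathlib
import HarnessLib
import Summits.HubbardSuperconductivity.HubbardSuperconductivity.Theorems.KLProgrammeKLRegimeScaleZeroTwoLegTailN
import Summits.HubbardSuperconductivity.HubbardSuperconductivity.Theorems.KLProgrammeKLRegimeScaleZeroDetBoundFreeBandSharp

/-!
# Route `KLProgramme`, ENGINE child (stmt-…-20437), stub (C) at `n = 0` (located #22, piece (a3)): the bare-frame tail doors at the SHARP determinant
# constant `δ₀ = 4` (`δ₀² = 16`; companions of `…ScaleZeroTwoLegTail3` / `…TailN`, which run at `δ₀² = 46`)

Cell gate-hubbard-kl, seat p1 (g18).  `…ScaleZeroDetBoundFreeBandSharp.isGramBoundedR_scaleZero_free_sharp_klEngL₃` gives `IsGramBoundedR (SᵀC⁰_{>e₀}S) √(2·(7+1))`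
at the bare frame on `klWindowC` under `klEngL₃ β U ≤ L`.  Re-running the generic doors `twoLeg_offDiag_moment_pow_sum_tail3_le` / `…tailN_le` at this constant:
* **`twoLeg_offDiag_moment_pow_sum_tail3_frameZero_le_sharp`** — `≤ (2/λ)ᵏ·2¹³·e²⁷·16³·a²·|U|³·β/(4M)` under `16e⁹·16·a·|U| ≤ 1/2`;
* **`twoLeg_offDiag_moment_pow_sum_tailN_frameZero_le_sharp`** — `≤ (2/λ)ᵏ·2·(16e⁹·16·|U|)·(16e⁹·16·a|U|)^{n₀−1}·β/(4M)`.
Same hypotheses and object as the `√46` versions otherwise (the `a`-sizes are the same hypotheses); factors `(16/46)³ ≈ 1/24`, `(16/46)^{n₀}`.  No definition; PROVED.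
-/

noncomputable section

namespace Summit.HubbardSuperconductivity.HubbardSuperconductivity.Theorems.EngineV8

set_option linter.dupNamespace false -- summit = problem name (single-conjunct summit), D-0017

open Real Finset Literature.MathematicalPhysics.QuantumLattice Literature.Probability.LatticeModels
open Literature.Probability.LatticeModels.BattleFederbush GrassmannAlgebra
open Summit.HubbardSuperconductivity.HubbardSuperconductivity.Theorems.KLRegimeSplit
open Summit.HubbardSuperconductivity.HubbardSuperconductivity.Theorems.DispersionFlow

variable {L : ℕ} [NeZero L] {M : ℕ} [NeZero M]

/-- **THE OFF-SITE `k`-TH MOMENT OF THE ORDER-≥3 TAIL AT THE BARE FRAME, CLOSED FORM** (every `k`, slope `0 < λ ≤ 1`): for `μ ∈ klWindowC`,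
`0 < U`, `klBetaMin ≤ β`, `klEngL₃ β U ≤ L`, every `M ≥ 1`, with `a > 0` the NORMALISED `(1+λ·diam)ᵏ`-weighted row/column size of the bare scale-`0`
grid covariance (`Σ_Y ‖C X Y‖·(1+λ·d(X,Y))ᵏ ≤ a·4M/β`, `d = gridLabelDist` at `β′ = β`) and the smallness `16·e⁹·16·a·|U| ≤ 1/2` (`= θ ≤ 1/2` at
`κ₀ = ρ = √16 = 4`, `…ScaleZeroDetBoundFreeBandSharp.isGramBoundedR_scaleZero_free_sharp_klEngL₃`):
`Σ_{p₁}[x⃗₁ ≠ x⃗₀](1+|Δx̃₀|+|Δx̃₁|)ᵏ·‖kernel₂ (W₀ − e^{Δ}V + ½(e^{Δ}V² − (e^{Δ}V)²)) ((p₀,σ,+),(p₁,σ,−))‖ ≤ (2/λ)ᵏ·2¹³·e²⁷·16³·a²·|U|³·β/(4M)` (×(16/46)³ ≈ 1/24 of `…Tail3`'s). -/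
theorem twoLeg_offDiag_moment_pow_sum_tail3_frameZero_le_sharp {μ : ℝ} (hμ : μ ∈ klWindowC) {U : ℝ} (hU : 0 < U) {β : ℝ}
    (hβ : klBetaMin ≤ β) (hL : klEngL₃ β U ≤ L) (k : ℕ) {lam : ℝ} (hlam0 : 0 < lam) (hlam1 : lam ≤ 1) {a : ℝ} (ha : 0 < a)
    (hrow : ∀ X, ∑ Y, ‖((hubbardGridSub L M β (2 * (2 * M))).transpose * hubbardCovAboveCT L M β μ 0 0 klE0 *
        hubbardGridSub L M β (2 * (2 * M))) X Y‖ *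
        diamWeight (fun s => (1 + lam * s) ^ k) (gridLabelDist L (2 * (2 * M)) β) {gridLegPos X, gridLegPos Y} ≤
          a * ((2 * (2 * M) : ℕ) : ℝ) / β)
    (hcol : ∀ Y, ∑ X, ‖((hubbardGridSub L M β (2 * (2 * M))).transpose * hubbardCovAboveCT L M β μ 0 0 klE0 *
        hubbardGridSub L M β (2 * (2 * M))) X Y‖ *
        diamWeight (fun s => (1 + lam * s) ^ k) (gridLabelDist L (2 * (2 * M)) β) {gridLegPos X, gridLegPos Y} ≤
          a * ((2 * (2 * M) : ℕ) : ℝ) / β)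
    (hsmall : 16 * Real.exp 1 ^ 9 * 16 * a * |U| ≤ 1 / 2)
    (σ : Fin 2) (p₀ : GridPoint L (2 * (2 * M))) :
    ∑ p₁ : GridPoint L (2 * (2 * M)), (if p₁.2 - p₀.2 = 0 then (0 : ℝ) else
        (1 + (((p₁.2 - p₀.2) 0).valMinAbs.natAbs : ℝ) + (((p₁.2 - p₀.2) 1).valMinAbs.natAbs : ℝ)) ^ k) *
      ‖kernel ℂ (effAction ℂ ((hubbardGridSub L M β (2 * (2 * M))).transpose * hubbardCovAboveCT L M β μ 0 0 klE0 *
              hubbardGridSub L M β (2 * (2 * M))) (hubbardGridInteraction L (2 * (2 * M)) β U) -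
          gaussConv ℂ ((hubbardGridSub L M β (2 * (2 * M))).transpose * hubbardCovAboveCT L M β μ 0 0 klE0 *
              hubbardGridSub L M β (2 * (2 * M))) (hubbardGridInteraction L (2 * (2 * M)) β U) +
          (2 : ℂ)⁻¹ • (gaussConv ℂ ((hubbardGridSub L M β (2 * (2 * M))).transpose * hubbardCovAboveCT L M β μ 0 0 klE0 *
                hubbardGridSub L M β (2 * (2 * M)))
              (hubbardGridInteraction L (2 * (2 * M)) β U * hubbardGridInteraction L (2 * (2 * M)) β U) -
            gaussConv ℂ ((hubbardGridSub L M β (2 * (2 * M))).transpose * hubbardCovAboveCT L M β μ 0 0 klE0 *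
                hubbardGridSub L M β (2 * (2 * M))) (hubbardGridInteraction L (2 * (2 * M)) β U) *
            gaussConv ℂ ((hubbardGridSub L M β (2 * (2 * M))).transpose * hubbardCovAboveCT L M β μ 0 0 klE0 *
                hubbardGridSub L M β (2 * (2 * M))) (hubbardGridInteraction L (2 * (2 * M)) β U)))
        2 (fun i => ((![p₀, p₁] i, σ), i))‖ ≤
      (2 / lam) ^ k * ((2 : ℝ) ^ 13 * Real.exp 1 ^ 27 * (16 : ℝ) ^ 3 * a ^ 2 * |U| ^ 3 * (β / ((2 * (2 * M) : ℕ) : ℝ))) := by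
  haveI : NeZero (2 * (2 * M)) := ⟨by have := NeZero.ne M; omega⟩
  have hβ0 : 0 < β := lt_of_lt_of_le (by norm_num [klBetaMin]) hβ
  have hN : (0 : ℝ) < ((2 * (2 * M) : ℕ) : ℝ) := by have := NeZero.ne M; positivity
  have h16 : (2 * (7 + 1) : ℝ) = 16 := by norm_num
  have hκ : (0 : ℝ) < Real.sqrt (2 * (7 + 1)) := Real.sqrt_pos.2 (by norm_num)
  have hκsq : Real.sqrt (2 * (7 + 1)) ^ 2 = 16 := by rw [Real.sq_sqrt (by norm_num), h16]
  have hGB := isGramBoundedR_scaleZero_free_sharp_klEngL₃ (L := L) (M := M) hμ hβ hL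
  have hα : 0 < a * ((2 * (2 * M) : ℕ) : ℝ) / β := by positivity
  have hθeq' := theta_frameZero_eq_gen (L := L) (M := M) hβ0 hκ U a
  have hθeq : Real.exp 1 * (a * ((2 * (2 * M) : ℕ) : ℝ) / β) *
      normV (GridLeg (GridPoint L (2 * (2 * M)))) (Real.sqrt (2 * (7 + 1))) (Real.sqrt (2 * (7 + 1)))
        (fun m' => if m' = 1 then |β| / ((2 * (2 * M) : ℕ) : ℝ) * (0 : TrigPolyC4v).coeffNorm 0
          else if m' = 2 then |U| * |β| / ((2 * (2 * M) : ℕ) : ℝ) else 0) / Real.sqrt (2 * (7 + 1)) ^ 2 =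
      16 * Real.exp 1 ^ 9 * 16 * a * |U| := by rw [hθeq', hκsq]
  have hθ0 : 0 ≤ 16 * Real.exp 1 ^ 9 * 16 * a * |U| := by positivity
  have hθlt : Real.exp 1 * (a * ((2 * (2 * M) : ℕ) : ℝ) / β) *
      normV (GridLeg (GridPoint L (2 * (2 * M)))) (Real.sqrt (2 * (7 + 1))) (Real.sqrt (2 * (7 + 1)))
        (fun m' => if m' = 1 then |β| / ((2 * (2 * M) : ℕ) : ℝ) * (0 : TrigPolyC4v).coeffNorm 0
          else if m' = 2 then |U| * |β| / ((2 * (2 * M) : ℕ) : ℝ) else 0) / Real.sqrt (2 * (7 + 1)) ^ 2 < 1 := by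
    rw [hθeq]; exact hsmall.trans_lt (by norm_num)
  have hP0 : ∀ m', 0 ≤ (if m' = 1 then |β| / ((2 * (2 * M) : ℕ) : ℝ) * (0 : TrigPolyC4v).coeffNorm 0
      else if m' = 2 then |U| * |β| / ((2 * (2 * M) : ℕ) : ℝ) else 0 : ℝ) := fun m' => by
    have := TrigPolyC4v.coeffNorm_nonneg 0 (0 : TrigPolyC4v); split_ifs <;> positivity
  have h := twoLeg_offDiag_moment_pow_sum_tail3_le _ β U k hβ0.le hlam0 hlam1 hκ hGB _ hP0
    (sum_norm_kernel_hubbardGridInteraction_mul_scaledPolyWt_le β U lam k) hα hrow hcol hκ hθlt σ p₀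
  refine h.trans ?_
  refine mul_le_mul_of_nonneg_left ?_ (by positivity)
  rw [hθeq]
  have hnV := normV_frameZero_eq (L := L) (M := M) (Real.sqrt (2 * (7 + 1))) (Real.sqrt (2 * (7 + 1))) β U
  rw [hnV]
  have he2 : Real.exp 2 = Real.exp 1 ^ 2 := by rw [← Real.exp_nat_mul]; norm_num
  have hθle : 16 * Real.exp 1 ^ 9 * 16 * a * |U| ≤ 1 / 2 := hsmall
  -- `X·θ²/(1−θ) ≤ 2·X·θ²` for `θ ≤ 1/2`
  have hX : 0 ≤ (Real.sqrt (2 * (7 + 1)))⁻¹ ^ 2 *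
      (Real.exp 1 * ((Real.exp 2 * (Real.sqrt (2 * (7 + 1)) + Real.sqrt (2 * (7 + 1)))) ^ 4 *
        (|U| * |β| / ((2 * (2 * M) : ℕ) : ℝ)))) := by positivity
  have hfrac : (Real.sqrt (2 * (7 + 1)))⁻¹ ^ 2 *
      (Real.exp 1 * ((Real.exp 2 * (Real.sqrt (2 * (7 + 1)) + Real.sqrt (2 * (7 + 1)))) ^ 4 *
        (|U| * |β| / ((2 * (2 * M) : ℕ) : ℝ)))) * (16 * Real.exp 1 ^ 9 * 16 * a * |U|) ^ 2 /
        (1 - 16 * Real.exp 1 ^ 9 * 16 * a * |U|) ≤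
      2 * ((Real.sqrt (2 * (7 + 1)))⁻¹ ^ 2 *
      (Real.exp 1 * ((Real.exp 2 * (Real.sqrt (2 * (7 + 1)) + Real.sqrt (2 * (7 + 1)))) ^ 4 *
        (|U| * |β| / ((2 * (2 * M) : ℕ) : ℝ))))) * (16 * Real.exp 1 ^ 9 * 16 * a * |U|) ^ 2 := by
    rw [div_le_iff₀ (by linarith)]
    have hsq : 0 ≤ (16 * Real.exp 1 ^ 9 * 16 * a * |U|) ^ 2 := sq_nonneg _
    nlinarith [mul_nonneg hX hsq]
  refine hfrac.trans (le_of_eq ?_)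
  -- algebra as in `…Tail3` with `46 ↦ 16`
  rw [abs_of_pos hβ0, abs_of_pos hU, he2]
  field_simp
  norm_num


/-- **THE OFF-SITE `k`-TH MOMENT OF THE ORDER-≥`n₀` TAIL AT THE BARE FRAME, CLOSED FORM** (every `k`, every `n₀ ≥ 1`, slope `0 < λ ≤ 1`): for
`μ ∈ klWindowC`, `0 < U`, `klBetaMin ≤ β`, `klEngL₃ β U ≤ L`, every `M ≥ 1`, with `a > 0` the normalised `(1+λ·diam)ᵏ`-weighted row/column size of the
bare scale-`0` grid covariance and `θ₀ := 16·e⁹·16·a·|U| ≤ 1/2` (δ₀² = 16):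
`Σ_{p₁}[x⃗₁ ≠ x⃗₀](1+|Δx̃₀|+|Δx̃₁|)ᵏ·‖kernel₂ (W₀ + Σ_{1≤n<n₀}(n!)⁻¹𝓔ᵀ(−V;n)) ((p₀,σ,+),(p₁,σ,−))‖ ≤ (2/λ)ᵏ·2·(16e⁹·16·|U|)·θ₀^{n₀−1}·β/(4M)`
— order `|U|^{n₀}` (×(16/46)^{n₀} of `…TailN`'s). -/
theorem twoLeg_offDiag_moment_pow_sum_tailN_frameZero_le_sharp {μ : ℝ} (hμ : μ ∈ klWindowC) {U : ℝ} (hU : 0 < U) {β : ℝ}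
    (hβ : klBetaMin ≤ β) (hL : klEngL₃ β U ≤ L) (k : ℕ) {lam : ℝ} (hlam0 : 0 < lam) (hlam1 : lam ≤ 1) {a : ℝ} (ha : 0 < a)
    (hrow : ∀ X, ∑ Y, ‖((hubbardGridSub L M β (2 * (2 * M))).transpose * hubbardCovAboveCT L M β μ 0 0 klE0 *
        hubbardGridSub L M β (2 * (2 * M))) X Y‖ *
        diamWeight (fun s => (1 + lam * s) ^ k) (gridLabelDist L (2 * (2 * M)) β) {gridLegPos X, gridLegPos Y} ≤
          a * ((2 * (2 * M) : ℕ) : ℝ) / β)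
    (hcol : ∀ Y, ∑ X, ‖((hubbardGridSub L M β (2 * (2 * M))).transpose * hubbardCovAboveCT L M β μ 0 0 klE0 *
        hubbardGridSub L M β (2 * (2 * M))) X Y‖ *
        diamWeight (fun s => (1 + lam * s) ^ k) (gridLabelDist L (2 * (2 * M)) β) {gridLegPos X, gridLegPos Y} ≤
          a * ((2 * (2 * M) : ℕ) : ℝ) / β)
    (hsmall : 16 * Real.exp 1 ^ 9 * 16 * a * |U| ≤ 1 / 2) {n₀ : ℕ} (hn₀ : 0 < n₀)
    (σ : Fin 2) (p₀ : GridPoint L (2 * (2 * M))) :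
    ∑ p₁ : GridPoint L (2 * (2 * M)), (if p₁.2 - p₀.2 = 0 then (0 : ℝ) else
        (1 + (((p₁.2 - p₀.2) 0).valMinAbs.natAbs : ℝ) + (((p₁.2 - p₀.2) 1).valMinAbs.natAbs : ℝ)) ^ k) *
      ‖kernel ℂ (effAction ℂ ((hubbardGridSub L M β (2 * (2 * M))).transpose * hubbardCovAboveCT L M β μ 0 0 klE0 *
              hubbardGridSub L M β (2 * (2 * M))) (hubbardGridInteraction L (2 * (2 * M)) β U)) 2 (fun i => ((![p₀, p₁] i, σ), i)) +
        ∑ n ∈ Ico 1 n₀, ((n.factorial : ℂ))⁻¹ *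
          kernel ℂ ((cumulantOf (fun k => evenGaussConv ℂ ((hubbardGridSub L M β (2 * (2 * M))).transpose *
              hubbardCovAboveCT L M β μ 0 0 klE0 * hubbardGridSub L M β (2 * (2 * M)))
            ((⟨-hubbardGridInteraction L (2 * (2 * M)) β U, neg_mem (hubbardGridInteraction_mem_evenPart β U)⟩ :
              evenPart ℂ (GridLeg (GridPoint L (2 * (2 * M))))) ^ k)) n : evenPart ℂ (GridLeg (GridPoint L (2 * (2 * M))))) :
                GrassmannAlgebra ℂ (GridLeg (GridPoint L (2 * (2 * M))))) 2 (fun i => ((![p₀, p₁] i, σ), i))‖ ≤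
      (2 / lam) ^ k * (2 * (16 * Real.exp 1 ^ 9 * 16 * |U|) * (16 * Real.exp 1 ^ 9 * 16 * a * |U|) ^ (n₀ - 1) *
        (β / ((2 * (2 * M) : ℕ) : ℝ))) := by
  haveI : NeZero (2 * (2 * M)) := ⟨by have := NeZero.ne M; omega⟩
  have hβ0 : 0 < β := lt_of_lt_of_le (by norm_num [klBetaMin]) hβ
  have hN : (0 : ℝ) < ((2 * (2 * M) : ℕ) : ℝ) := by have := NeZero.ne M; positivity
  have h16 : (2 * (7 + 1) : ℝ) = 16 := by norm_num
  have hκ : (0 : ℝ) < Real.sqrt (2 * (7 + 1)) := Real.sqrt_pos.2 (by norm_num)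
  have hκsq : Real.sqrt (2 * (7 + 1)) ^ 2 = 16 := by rw [Real.sq_sqrt (by norm_num), h16]
  have hGB := isGramBoundedR_scaleZero_free_sharp_klEngL₃ (L := L) (M := M) hμ hβ hL
  have hα : 0 < a * ((2 * (2 * M) : ℕ) : ℝ) / β := by positivity
  have hθeq' := theta_frameZero_eq_gen (L := L) (M := M) hβ0 hκ U a
  have hθeq : Real.exp 1 * (a * ((2 * (2 * M) : ℕ) : ℝ) / β) *
      normV (GridLeg (GridPoint L (2 * (2 * M)))) (Real.sqrt (2 * (7 + 1))) (Real.sqrt (2 * (7 + 1)))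
        (fun m' => if m' = 1 then |β| / ((2 * (2 * M) : ℕ) : ℝ) * (0 : TrigPolyC4v).coeffNorm 0
          else if m' = 2 then |U| * |β| / ((2 * (2 * M) : ℕ) : ℝ) else 0) / Real.sqrt (2 * (7 + 1)) ^ 2 =
      16 * Real.exp 1 ^ 9 * 16 * a * |U| := by rw [hθeq', hκsq]
  have hθ0 : 0 ≤ 16 * Real.exp 1 ^ 9 * 16 * a * |U| := by positivity
  have hθlt : Real.exp 1 * (a * ((2 * (2 * M) : ℕ) : ℝ) / β) *
      normV (GridLeg (GridPoint L (2 * (2 * M)))) (Real.sqrt (2 * (7 + 1))) (Real.sqrt (2 * (7 + 1)))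
        (fun m' => if m' = 1 then |β| / ((2 * (2 * M) : ℕ) : ℝ) * (0 : TrigPolyC4v).coeffNorm 0
          else if m' = 2 then |U| * |β| / ((2 * (2 * M) : ℕ) : ℝ) else 0) / Real.sqrt (2 * (7 + 1)) ^ 2 < 1 := by
    rw [hθeq]; exact hsmall.trans_lt (by norm_num)
  have hP0 : ∀ m', 0 ≤ (if m' = 1 then |β| / ((2 * (2 * M) : ℕ) : ℝ) * (0 : TrigPolyC4v).coeffNorm 0
      else if m' = 2 then |U| * |β| / ((2 * (2 * M) : ℕ) : ℝ) else 0 : ℝ) := fun m' => by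
    have := TrigPolyC4v.coeffNorm_nonneg 0 (0 : TrigPolyC4v); split_ifs <;> positivity
  have h := twoLeg_offDiag_moment_pow_sum_tailN_le _ β U k hβ0.le hlam0 hlam1 hκ hGB _ hP0
    (sum_norm_kernel_hubbardGridInteraction_mul_scaledPolyWt_le β U lam k) hα hrow hcol hκ hθlt hn₀ σ p₀
  refine h.trans ?_
  refine mul_le_mul_of_nonneg_left ?_ (by positivity)
  rw [hθeq]
  have hnV := normV_frameZero_eq (L := L) (M := M) (Real.sqrt (2 * (7 + 1))) (Real.sqrt (2 * (7 + 1))) β U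
  rw [hnV]
  have he2 : Real.exp 2 = Real.exp 1 ^ 2 := by rw [← Real.exp_nat_mul]; norm_num
  -- the prefactor identity: `√16⁻²·e·(e²(√16+√16))⁴·|U||β|/N = 16e⁹·16·|U|·β/N`
  have hs4 : Real.sqrt (2 * (7 + 1)) ^ 4 = (16 : ℝ) ^ 2 := by
    rw [show (4 : ℕ) = 2 * 2 from rfl, pow_mul, hκsq]
  have hX : (Real.sqrt (2 * (7 + 1)))⁻¹ ^ 2 *
      (Real.exp 1 * ((Real.exp 2 * (Real.sqrt (2 * (7 + 1)) + Real.sqrt (2 * (7 + 1)))) ^ 4 *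
        (|U| * |β| / ((2 * (2 * M) : ℕ) : ℝ)))) = 16 * Real.exp 1 ^ 9 * 16 * |U| * (β / ((2 * (2 * M) : ℕ) : ℝ)) := by
    have hsum : Real.sqrt (2 * (7 + 1)) + Real.sqrt (2 * (7 + 1)) = 2 * Real.sqrt (2 * (7 + 1)) := by ring
    rw [hsum, abs_of_pos hβ0, he2, inv_pow, hκsq]
    have : (Real.exp 1 ^ 2 * (2 * Real.sqrt (2 * (7 + 1)))) ^ 4 = Real.exp 1 ^ 8 * 16 * (16 : ℝ) ^ 2 := by
      rw [mul_pow, mul_pow, ← pow_mul, hs4]; ring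
    rw [this]
    field_simp
  set X := (Real.sqrt (2 * (7 + 1)))⁻¹ ^ 2 *
      (Real.exp 1 * ((Real.exp 2 * (Real.sqrt (2 * (7 + 1)) + Real.sqrt (2 * (7 + 1)))) ^ 4 *
        (|U| * |β| / ((2 * (2 * M) : ℕ) : ℝ)))) with hXdef
  set θ₀ := 16 * Real.exp 1 ^ 9 * 16 * a * |U| with hθ₀
  have hX0 : 0 ≤ X := by rw [hXdef]; positivity
  have hθle : θ₀ ≤ 1 / 2 := hsmall
  have hpow0 : 0 ≤ θ₀ ^ (n₀ - 1) := pow_nonneg hθ0 _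
  -- `X·θ₀^{n₀-1}/(1−θ₀) ≤ 2·X·θ₀^{n₀-1}`
  have hfrac : X * θ₀ ^ (n₀ - 1) / (1 - θ₀) ≤ 2 * X * θ₀ ^ (n₀ - 1) := by
    rw [div_le_iff₀ (by linarith)]
    nlinarith [mul_nonneg hX0 hpow0]
  refine hfrac.trans (le_of_eq ?_)
  rw [hX]; ring


end Summit.HubbardSuperconductivity.HubbardSuperconductivity.Theorems.EngineV8

end
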